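import Summits.ABC.ABC.Theses.DefiniteXi
import Literature.NumberTheory.EllipticCurves.OpenImageMazurAssemblyProofs
import Literature.NumberTheory.EllipticCurves.OpenImageMazurInertiaThreeProofs
import Literature.NumberTheory.EllipticCurves.OpenImageMazurTwistProofs
import Literature.NumberTheory.EllipticCurves.CyclicIsogenyCharacterFrobeniusProofs
import Literature.NumberTheory.EllipticCurves.RationalIsogenyFrobeniusCriterionPrimePower
import Literature.NumberTheory.EllipticCurves.RationalIsogenyDegreesProofs
import Literature.NumberTheory.EllipticCurves.KernelReductionInertiaProofs
import Literature.NumberTheory.EllipticCurves.SemistableModPImageMultiplicativeProofs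
import Literature.NumberTheory.EllipticCurves.SupersingularModPDecompositionImageProofs
import Literature.NumberTheory.EllipticCurves.QuadraticTwistTateFormProofs
import Literature.NumberTheory.EllipticCurves.WeilPairingCyclicComponentsDeterminantProofs
import Literature.NumberTheory.EllipticCurves.DivisionFieldRamificationPrimePowProofs
import Literature.NumberTheory.EllipticCurves.DivisionFieldRamificationPotMultProofs
import Literature.NumberTheory.EllipticCurves.IsogenyFrobeniusTraceProofs
import HarnessLib

/-!
# Stub-ideation k=2 (gen 5, FAMILY 2 — RESHAPE) for `stub_pasten163` — crux `DefiniteRTControlPrime`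

Companion to `STUB-IDEAS-stub_pasten163-2.md` (gen 5; supersedes gen 4's
`Lines/StubIdeasK2g4_pasten163.lean`).  Typed OUTPUT kept compatible: `frobNorm`, A1, T1 (proved,
verbatim), `FreyIsogenyDiameter` (= k1's `…Sketch.Ideas1.FreyIsogenyDiameter`), so k1's
`definiteRTControlPrime_of_diameter` applies unchanged; the counting end is now a CUBE (C0³).
Every `sorry` is a HELPER for the stub prover (one prover cycle each); COVER, OPEN, C1³ are proved.

Plan A (verbatim stub) = `IsogenyGlueCongruence.MazurKenkuBound` (stmt-ABC-15125, `Iff.rfl`); `163`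
is attained (`PastenShimura2024_minimalDegree_le_163_mul_iff`) — import by name only.

Plan B, GEN-5 CUT — "DIAGONAL MIDDLE CURVE + EXACT CONTAINERS" (reshape of the OBJECT):
a cyclic `ℓᵏ`-isogeny (`ℓ` odd, `k ≥ 2`) is read on its MIDDLE curve `V₁` (`m = ⌊k/2⌋`), where
`V₁[ℓᵐ] = ℤP₁ ⊕ ℤP₂` with BOTH lines `Γ_ℚ`-stable (M1, pattern = landed `middleSeven`).  With two
complementary stable lines every local statement is EXACT — no depth, no `⌈k/2⌉`, no sandwich:
* (CONT) at each inertia group a CONTAINER `K ⊇ (τ−1)·V₁[ℓᵐ]` whose `ℓ`-torsion has `≤ ℓ` points: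
  multiplicative `v ∤ ℓ` — LANDED Tate basis `exists_tateBasis_geomTorsion_of_hasMultiplicativeReductionAt`
  (`K = ℤP₁ᵀ`); multiplicative `v ∣ ℓ` — kernel of reduction of the Tate form (`1 ↦ m` port of the
  landed `exists_addSubgroup_card_le_of_hasMultiplicativeReductionAt`); good ordinary `v ∣ ℓ` —
  kernel of reduction (re-cut of the landed `card_map_smul_sub_geomTorsion_le_pow`); supersingular
  is excluded by the stable `ℓ`-line (SS);
* (DICH) pure group theory: `(r₁(τ)−1)P₁, (r₂(τ)−1)P₂ ∈ K`, `ℤP₁ ∩ ℤP₂ = 0`, `#K[ℓ] ≤ ℓ`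
  ⟹ `r₁(τ) = 1 ∨ r₂(τ) = 1`; (COVER) a group is not a union of two proper subgroups ⟹ on each
  inertia group ONE of `r₁, r₂` is trivial; with `r₁r₂ = χ_{ℓᵐ}` (LANDED
  `intCast_mul_eq_modNCyclotomicCharacter_of_smul_eq_zsmul`) both are trivial at multiplicative `v ∤ ℓ`;
  at `2`: T1 (`v₂(j) ≥ 0`, proved) / TW2 (`v₂(j) < 0`: twist + CONT, `rᵢ² = 1`);
* (GLOB) hence one of `r₁¹², r₂¹²` is unramified EVERYWHERE ⟹ trivial
  (`Mazur1978.monoidHom_eq_one_of_forall_inertia`); Frobenius root (landed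
  `cyclicCharacter_sq_sub_frobeniusTrace_mul_add_eq_zero`) + A1 (branch `t¹² = 1`) ⟹ `ℓᵐ ∣ n₁₂(p)`
  at FULL level `m` on the middle curve; `k = 1` is the prime-level Mazur/Serre assembly (PRIME);
  `k ≤ 3·max(1,⌊k/2⌋)` ⟹ `d_odd ∣ (n₁₂(p₀)n₁₂(p₁))³` (C0³), `2`-part `∣ 16` (landed level `32`).
Removed w.r.t. gen 4: CMP, DET-coset, ALG1, ALG2, LOCℓ-depth, MK-at-depth, U2, T2, `Depth`, `halfCeil`.
-/

namespace Summit.ABC.ABC.Cruxes.DefiniteRTControlPrime.Sketch.Ideas2g5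

open Literature.NumberTheory.EllipticCurves Literature.NumberTheory.GaloisRepresentations
open WeierstrassCurve IsDedekindDomain NumberField Field

/-! ## §0 Carried verbatim from gen 4 (T1, A1 PROVED; `frobNorm`; G0; SS) -/

/-- T1 (PROVED): `j` integral at a place `v ∤ 3m` ⇒ `r(τ)¹² = 1` on inertia at `v`.  Used at `v = 2`. -/
theorem cyclicCharacter_pow_twelve_eq_one_of_valuation_j_le_one (W : WeierstrassCurve ℚ)
    [W.IsElliptic] {m : ℕ} [NeZero m] {P : geomPoints W} (hP : addOrderOf P = m)
    {r : absoluteGaloisGroup ℚ →* (ZMod m)ˣ}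
    (hr : ∀ σ : absoluteGaloisGroup ℚ, σ • P = ((r σ : (ZMod m)ˣ) : ZMod m).val • P)
    {v : HeightOneSpectrum (𝓞 ℚ)} (h3 : (3 : 𝓞 ℚ) ∉ v.asIdeal) (hmv : (m : 𝓞 ℚ) ∉ v.asIdeal)
    (hj : v.valuation ℚ W.j ≤ 1)
    {𝔓 : Ideal (absIntegers (𝓞 ℚ) ℚ)} (h𝔓 : 𝔓 ∈ v.primesAbove)
    {τ : absoluteGaloisGroup ℚ} (hτ : τ ∈ 𝔓.inertia (absoluteGaloisGroup ℚ)) :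
    r τ ^ 12 = 1 := by
  have hmP : m • P = 0 := by rw [← hP]; exact addOrderOf_nsmul_eq_zero P
  have h12 : τ ^ 12 • P = P :=
    Mazur1978.pow_twelve_smul_eq_of_mem_inertia_of_valuation_j_le_one_of_three W h3 hj h𝔓 hτ hmv hmP
  have h' : ((r (τ ^ 12) : (ZMod m)ˣ) : ZMod m).val • P = P := by rw [← hr]; exact h12
  have h1 : ((r (τ ^ 12) : (ZMod m)ˣ) : ZMod m) = 1 :=
    Mazur1978.eq_one_of_val_smul_eq_of_addOrderOf W hP h'
  rw [map_pow] at h1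
  exact Units.val_eq_one.mp h1

/-- `n₁₂(p) = p¹² + 1 − s₁₂(a_p, p) = #E(𝔽_{p¹²})` (as an integer). -/
noncomputable def frobNorm (W : WeierstrassCurve ℚ) [W.IsGloballyMinimal] (p : ℕ) : ℤ :=
  (p : ℤ) ^ 12 + 1 - Mazur1978.frobTracePow (W.frobeniusTrace p) p 12

/-- A1 (PROVED): a root `t` of `X² − aX + p` in `ℤ/n` (`p` a unit) with `t¹² = 1` OR `t¹² = p¹²`
forces `n ∣ p¹² + 1 − s₁₂(a,p)`.  (Gen 5 uses branch 1 for `k ≥ 2`, both branches in PRIME.) -/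
theorem natCast_dvd_frobNorm_of_pow_twelve {n p : ℕ} [NeZero n] (a : ℤ) (hp : IsUnit (p : ZMod n))
    {t : ZMod n} (hroot : t ^ 2 - (a : ZMod n) * t + (p : ZMod n) = 0)
    (ht : t ^ 12 = 1 ∨ t ^ 12 = (p : ZMod n) ^ 12) :
    (n : ℤ) ∣ (p : ℤ) ^ 12 + 1 - Mazur1978.frobTracePow a p 12 := by
  have hprod' : t * ((a : ZMod n) - t) = (p : ZMod n) := by
    linear_combination (-1 : ZMod n) * hroot
  have hsum : t + ((a : ZMod n) - t) = ((a : ℤ) : ZMod n) := by ring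
  have hprod : t * ((a : ZMod n) - t) = (((p : ℕ) : ℤ) : ZMod n) := by
    rw [hprod', Int.cast_natCast]
  have hspec := Mazur1978.frobTracePow_spec hsum hprod 12
  have h12 : ((a : ZMod n) - t) ^ 12 * t ^ 12 = (p : ZMod n) ^ 12 := by
    rw [← mul_pow, mul_comm, hprod']
  rw [← ZMod.intCast_zmod_eq_zero_iff_dvd]
  push_cast
  rw [← hspec]
  rcases ht with h1 | h2
  · rw [h1, mul_one] at h12
    rw [h1, h12]; ring
  · rw [h2] at h12
    have h3 : ((a : ZMod n) - t) ^ 12 = 1 :=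
      (hp.pow 12).mul_right_cancel (h12.trans (one_mul _).symm)
    rw [h2, h3]; ring

/-- G0 (XS glue, gen 4 verbatim; used only for `k = 1` now): the `ℓ`-primary part of the kernel of a
cyclic isogeny contains a stable cyclic line of order `ℓ^{k}` for every `ℓᵏ ∣ deg`. -/
theorem exists_stableLine_of_isCyclic {W₁ W₂ : WeierstrassCurve ℚ} [W₁.IsElliptic] [W₂.IsElliptic]
    (φ : Isogeny W₁ W₂) (hφ : φ.IsCyclic) (ℓ k : ℕ) [Fact ℓ.Prime] (hdiv : ℓ ^ k ∣ φ.degree) :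
    ∃ P : geomPoints W₁, addOrderOf P = ℓ ^ k ∧
      ∀ σ : absoluteGaloisGroup ℚ, σ • P ∈ AddSubgroup.zmultiples P := by
  sorry

/-- SS (S, gen 4 verbatim): a `Γ_ℚ`-stable point of prime order `ℓ ≥ 3` excludes good SUPERSINGULAR
reduction at `ℓ` (the `exfalso` branch of `Mazur1978.modEq_zero_or_one_of_hasGoodReductionAtPrime`,
`isCyclic_and_card_inertia_map_of_dvd_frobeniusTrace_all`).  Apply to `ℓ^{m−1}·P₁`. -/
theorem not_dvd_frobeniusTrace_of_stableLine (W : WeierstrassCurve ℚ) [W.IsElliptic]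
    [W.IsGloballyMinimal] (ℓ : ℕ) [Fact ℓ.Prime] (hℓ3 : 3 ≤ ℓ)
    (hgood : W.HasGoodReductionAtPrime ℓ) {P : geomPoints W} (hP : addOrderOf P = ℓ)
    (hst : ∀ σ : absoluteGaloisGroup ℚ, σ • P ∈ AddSubgroup.zmultiples P) :
    ¬ ((ℓ : ℤ) ∣ W.frobeniusTrace ℓ) := by
  sorry

/-! ## §1 M1 — the NEW OBJECT: the middle curve of a cyclic `ℓᵏ`-isogeny carries two complementary
stable lines of order `ℓ^⌊k/2⌋` -/

/-- M1 (M, one cycle; pattern = landed `CyclicIsogenyFortyNineMiddleCurveProofs.middleSeven`, which is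
the case `ℓᵏ = 49`): `ψ` cyclic of degree `ℓᵏ`, `k ≥ 2`, `a := k − ⌊k/2⌋`, `ker ψ = ℤP`.  Quotient
`g : V → V/ℤ(ℓ^{⌊k/2⌋}P)` (`exists_isogeny_ker_eq_and_comp_eq_nsmul_holds`; kernel of order `ℓᵃ`… see md:
divide by `S = ℤ(ℓ^{k−a}P)`, `#S = ℓᵃ`), then a globally minimal model (`hasGlobalMinimalModel_rat_holds`,
`VariableChange.toIsogeny`).  Lines: `P₁ := g P` (order `ℓᵐ`, stable: image of the stable `ℤP`),
`P₂ := ℓ^{a−m} • g T` for `T` with `V[ℓᵃ] = ℤ(ℓᵐP) ⊕ ℤT` (gen-4 CMP `exists_quotientGenerator`;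
`g(V[ℓᵃ])` is stable, cyclic of order `ℓᵃ`); `ℤP₁ ∩ ℤP₂ = 0` since `xP ∈ V[ℓᵃ] + S ⟹ ℓᵐ ∣ x`. -/
theorem exists_middleCurve {V V' : WeierstrassCurve ℚ} [V.IsElliptic] [V'.IsElliptic]
    (ψ : Isogeny V V') (hψ : ψ.IsCyclic) (ℓ k : ℕ) [Fact ℓ.Prime] (hk : 2 ≤ k)
    (hdeg : ψ.degree = ℓ ^ k) :
    ∃ (V₁ : WeierstrassCurve ℚ) (_ : V₁.IsElliptic) (_ : V₁.IsGloballyMinimal)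
      (P₁ P₂ : geomPoints V₁),
      V.IsIsogenous V₁ ∧ addOrderOf P₁ = ℓ ^ (k / 2) ∧ addOrderOf P₂ = ℓ ^ (k / 2) ∧
      (∀ σ : absoluteGaloisGroup ℚ, σ • P₁ ∈ AddSubgroup.zmultiples P₁) ∧
      (∀ σ : absoluteGaloisGroup ℚ, σ • P₂ ∈ AddSubgroup.zmultiples P₂) ∧
      AddSubgroup.zmultiples P₁ ⊓ AddSubgroup.zmultiples P₂ = ⊥ := by
  sorry

/-- DIAG (S): two disjoint cyclic lines of order `ℓᵐ` SPAN `W[ℓᵐ]` (`#W[ℓᵐ] = ℓ^{2m}`,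
`natCard_geomTorsion_eq_sq`; the map `ℤ/ℓᵐ × ℤ/ℓᵐ → W[ℓᵐ]` is injective by disjointness, hence onto).
This is the `hspan` input of the landed determinant lemma. -/
theorem exists_zsmul_add_zsmul_of_disjoint (W : WeierstrassCurve ℚ) [W.IsElliptic] {ℓ m : ℕ}
    [Fact ℓ.Prime] {P₁ P₂ : geomPoints W} (hP₁ : addOrderOf P₁ = ℓ ^ m)
    (hP₂ : addOrderOf P₂ = ℓ ^ m)
    (hdisj : AddSubgroup.zmultiples P₁ ⊓ AddSubgroup.zmultiples P₂ = ⊥)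
    {Q : geomPoints W} (hQ : ℓ ^ m • Q = 0) : ∃ c₁ c₂ : ℤ, Q = c₁ • P₁ + c₂ • P₂ := by
  sorry

/-! ## §2 The local EXACT tools: DICH (group theory), COVER (proved), containers -/

/-- DICH (S, pure group theory, one cycle): if `c₁P₁, c₂P₂` both lie in a subgroup `K` whose
`ℓ`-torsion has at most `ℓ` points, the lines `ℤP₁, ℤP₂` (of `ℓ`-power order) being disjoint, then
one of them is `0`.  Proof: else `ℓ^{j₁−1}c₁P₁ ∈ K ∩ ℤP₁` and `ℓ^{j₂−1}c₂P₂ ∈ K ∩ ℤP₂` have order `ℓ`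
and generate DISTINCT order-`ℓ` subgroups of `K[ℓ]` (disjointness), so `#K[ℓ] ≥ ℓ + 1`.
(`K ⊓ W[ℓ]` is finite: `W[ℓ]` is.) -/
theorem zsmul_eq_zero_or_of_card_inf_torsion_le (W : WeierstrassCurve ℚ) [W.IsElliptic] {ℓ : ℕ}
    [Fact ℓ.Prime] {a b : ℕ} {P₁ P₂ : geomPoints W} (hP₁ : addOrderOf P₁ = ℓ ^ a)
    (hP₂ : addOrderOf P₂ = ℓ ^ b)
    (hdisj : AddSubgroup.zmultiples P₁ ⊓ AddSubgroup.zmultiples P₂ = ⊥)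
    {K : AddSubgroup (geomPoints W)} (hK : Nat.card ↥(K ⊓ geomTorsion W (ℓ : ℤ)) ≤ ℓ)
    {c₁ c₂ : ℤ} (h₁ : c₁ • P₁ ∈ K) (h₂ : c₂ • P₂ ∈ K) : c₁ • P₁ = 0 ∨ c₂ • P₂ = 0 := by
  sorry

/-- COVER (PROVED): a group is not the union of two proper subgroups — the per-`τ` dichotomy is
uniform on an inertia group.  Use with `A = r₁.ker`, `B = r₂.ker`. -/
theorem forall_mem_or_forall_mem_of_forall_or {G : Type*} [Group G] (I A B : Subgroup G)
    (h : ∀ x ∈ I, x ∈ A ∨ x ∈ B) : (∀ x ∈ I, x ∈ A) ∨ (∀ x ∈ I, x ∈ B) := by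
  by_contra hc
  push_neg at hc
  obtain ⟨⟨x, hxI, hxA⟩, ⟨y, hyI, hyB⟩⟩ := hc
  have hxB : x ∈ B := (h x hxI).resolve_left hxA
  have hyA : y ∈ A := (h y hyI).resolve_right hyB
  rcases h (x * y) (I.mul_mem hxI hyI) with hxy | hxy
  · exact hxA (by simpa using A.mul_mem hxy (A.inv_mem hyA))
  · exact hyB (by simpa using B.mul_mem (B.inv_mem hxB) hxy)

/-- CONT (S, from the LANDED global Tate basis
`exists_tateBasis_geomTorsion_of_hasMultiplicativeReductionAt`, `K = ℤP₁ᵀ`; `#(ℤP₁ᵀ)[ℓ] ≤ ℓ` since a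
cyclic `ℓ`-group has `≤ ℓ` elements killed by `ℓ`, `IsAddCyclic.card_nsmul_eq_zero_le`-pattern):
multiplicative `v ∤ ℓ` (ANY residue characteristic, incl. `2`). -/
theorem exists_container_of_hasMultiplicativeReductionAt (W : WeierstrassCurve ℚ) [W.IsElliptic]
    {ℓ : ℕ} [Fact ℓ.Prime] {v : HeightOneSpectrum (𝓞 ℚ)} (hℓv : (ℓ : 𝓞 ℚ) ∉ v.asIdeal)
    (hmult : W.HasMultiplicativeReductionAt v)
    {𝔓 : Ideal (absIntegers (𝓞 ℚ) ℚ)} (h𝔓 : 𝔓 ∈ v.primesAbove) {m : ℕ} (hm : 1 ≤ m) :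
    ∃ K : AddSubgroup (geomPoints W), Nat.card ↥(K ⊓ geomTorsion W (ℓ : ℤ)) ≤ ℓ ∧
      (∀ τ ∈ 𝔓.inertia (absoluteGaloisGroup ℚ), ∀ Q ∈ K, τ • Q = Q) ∧
      ∀ τ ∈ 𝔓.inertia (absoluteGaloisGroup ℚ), ∀ Q ∈ geomTorsion W ((ℓ ^ m : ℕ) : ℤ),
        τ • Q - Q ∈ K := by
  sorry

/-- CONTℓ (S–M, one cycle; the `1 ↦ m` PORT of the landed
`exists_addSubgroup_card_le_of_hasMultiplicativeReductionAt`, whose container is the kernel of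
reduction `T₁` of the Tate form of invariant `j` over `ℚ_ℓ` — `τ`-INDEPENDENT; its `ℓ`-torsion has
`≤ ℓ` points by `TateForm.card_addSubgroup_le_pow … 1`; the only change is `P ∈ E[ℓ] ↦ P ∈ E[ℓᵐ]`
in `TateForm.one_lt_valuation_of_map_sub_eq_some_of_zsmul_eq_zero`): multiplicative `v ∣ ℓ`, `ℓ` odd. -/
theorem exists_container_of_hasMultiplicativeReductionAt_self (W : WeierstrassCurve ℚ)
    [W.IsElliptic] {ℓ : ℕ} [Fact ℓ.Prime] (hℓ2 : ℓ ≠ 2) {v : HeightOneSpectrum (𝓞 ℚ)}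
    (hℓv : (ℓ : 𝓞 ℚ) ∈ v.asIdeal) (hmult : W.HasMultiplicativeReductionAt v)
    {𝔓 : Ideal (absIntegers (𝓞 ℚ) ℚ)} (h𝔓 : 𝔓 ∈ v.primesAbove) (m : ℕ) :
    ∃ K : AddSubgroup (geomPoints W), Nat.card ↥(K ⊓ geomTorsion W (ℓ : ℤ)) ≤ ℓ ∧
      ∀ τ ∈ 𝔓.inertia (absoluteGaloisGroup ℚ), ∀ Q ∈ geomTorsion W ((ℓ ^ m : ℕ) : ℤ),
        τ • Q - Q ∈ K := by
  sorry

/-- ORD (S, one cycle; re-cut of the landed `WeierstrassCurve.card_map_smul_sub_geomTorsion_le_pow`,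
Serre 1968 IV A.2.2: its proof transports `(τ−1)·W[ℓᵐ]` by `Ψ` INTO THE KERNEL OF REDUCTION
(`exists_map_smul_sub_reducesToZero`) and counts with `card_addSubgroup_le_pow_of_hasseCoeff … m`; take
`K := Ψ⁻¹(kernel of reduction)` and count its `ℓ`-torsion with the same lemma at exponent `1`.  The
good ordinary model `(C, M, IsUnit M.Δ, IsUnit (M.hasseCoeff ℓ))` is produced from `[IsGloballyMinimal]
+ HasGoodReductionAtPrime ℓ + ℓ ∤ a_ℓ` exactly as in gen-4 Xo (`intCast_frobeniusTrace_eq_hasseCoeff`). -/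
theorem exists_container_of_ordinary (W : WeierstrassCurve ℚ) [W.IsElliptic] [W.IsGloballyMinimal]
    {ℓ : ℕ} [Fact ℓ.Prime] (hℓ2 : ℓ ≠ 2) (hgood : W.HasGoodReductionAtPrime ℓ)
    (hord : ¬ ((ℓ : ℤ) ∣ W.frobeniusTrace ℓ)) {v : HeightOneSpectrum (𝓞 ℚ)}
    (hℓv : (ℓ : 𝓞 ℚ) ∈ v.asIdeal) {𝔓 : Ideal (absIntegers (𝓞 ℚ) ℚ)} (h𝔓 : 𝔓 ∈ v.primesAbove)
    {τ : absoluteGaloisGroup ℚ} (hτ : τ ∈ 𝔓.inertia (absoluteGaloisGroup ℚ)) (m : ℕ) :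
    ∃ K : AddSubgroup (geomPoints W), Nat.card ↥(K ⊓ geomTorsion W (ℓ : ℤ)) ≤ ℓ ∧
      ∀ Q ∈ geomTorsion W ((ℓ ^ m : ℕ) : ℤ), τ • Q - Q ∈ K := by
  sorry

/-! ## §3 Characters of a diagonal pair: determinant (landed), local exactness, the place `2` -/

/-- DET (S): `r₁ · r₂ = χ_{n}` for a disjoint pair of stable lines of order `n` — the landed
`intCast_mul_eq_modNCyclotomicCharacter_of_smul_eq_zsmul` on `geomTorsion W n` with `hspan` := DIAG. -/
theorem cyclicCharacter_mul_eq_modNCyclotomicCharacter (W : WeierstrassCurve ℚ) [W.IsElliptic]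
    {n : ℕ} [NeZero n] [NeZero (n : ℚ)] (hn : 2 ≤ n) {P₁ P₂ : geomPoints W}
    (hP₁ : addOrderOf P₁ = n) (hP₂ : addOrderOf P₂ = n)
    (hdisj : AddSubgroup.zmultiples P₁ ⊓ AddSubgroup.zmultiples P₂ = ⊥)
    {r₁ r₂ : absoluteGaloisGroup ℚ →* (ZMod n)ˣ}
    (hr₁ : ∀ σ : absoluteGaloisGroup ℚ, σ • P₁ = ((r₁ σ : (ZMod n)ˣ) : ZMod n).val • P₁)
    (hr₂ : ∀ σ : absoluteGaloisGroup ℚ, σ • P₂ = ((r₂ σ : (ZMod n)ˣ) : ZMod n).val • P₂)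
    (σ : absoluteGaloisGroup ℚ) : r₁ σ * r₂ σ = modNCyclotomicCharacter ℚ n σ := by
  sorry

/-- OPEN (PROVED; `1 ↦ m` of the landed `Mazur1978.isOpen_ker_of_smul_eq`): the character of a stable
cyclic line has open kernel — the continuity input of `Mazur1978.monoidHom_eq_one_of_forall_inertia`. -/
theorem isOpen_ker_of_smul_eq_of_addOrderOf (W : WeierstrassCurve ℚ) [W.IsElliptic] {m : ℕ}
    [NeZero m] {P : geomPoints W} (hP : addOrderOf P = m)
    {r : absoluteGaloisGroup ℚ →* (ZMod m)ˣ}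
    (hr : ∀ σ : absoluteGaloisGroup ℚ, σ • P = ((r σ : (ZMod m)ˣ) : ZMod m).val • P) :
    IsOpen ((r.ker : Subgroup (absoluteGaloisGroup ℚ)) : Set (absoluteGaloisGroup ℚ)) := by
  refine Subgroup.isOpen_mono (H₁ := MulAction.stabilizer (absoluteGaloisGroup ℚ) P) ?_
    (isOpen_stabilizer_point_holds W P)
  intro σ hσ
  rw [MulAction.mem_stabilizer_iff] at hσ
  rw [MonoidHom.mem_ker]
  have hfix : ((r σ : (ZMod m)ˣ) : ZMod m).val • P = P := by rw [← hr σ]; exact hσ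
  exact Units.val_eq_one.mp (Mazur1978.eq_one_of_val_smul_eq_of_addOrderOf W hP hfix)

/-- MULT (S assembly: CONT + DICH per `τ`, then DET + `χ_{ℓᵐ}` unramified at `v ∤ ℓ`
(`modNCyclotomicCharacter_eq_one_of_mem_inertia`) to get BOTH): at a multiplicative place `v ∤ ℓ`
(any residue characteristic) both characters of a diagonal pair are trivial on inertia — EXACTLY. -/
theorem cyclicCharacter_eq_one_of_hasMultiplicativeReductionAt_of_disjoint (W : WeierstrassCurve ℚ)
    [W.IsElliptic] {ℓ m : ℕ} [Fact ℓ.Prime] (hm : 1 ≤ m) {P₁ P₂ : geomPoints W}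
    (hP₁ : addOrderOf P₁ = ℓ ^ m) (hP₂ : addOrderOf P₂ = ℓ ^ m)
    (hdisj : AddSubgroup.zmultiples P₁ ⊓ AddSubgroup.zmultiples P₂ = ⊥)
    {r₁ r₂ : absoluteGaloisGroup ℚ →* (ZMod (ℓ ^ m))ˣ}
    (hr₁ : ∀ σ : absoluteGaloisGroup ℚ, σ • P₁ = ((r₁ σ : (ZMod (ℓ ^ m))ˣ) : ZMod (ℓ ^ m)).val • P₁)
    (hr₂ : ∀ σ : absoluteGaloisGroup ℚ, σ • P₂ = ((r₂ σ : (ZMod (ℓ ^ m))ˣ) : ZMod (ℓ ^ m)).val • P₂)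
    {v : HeightOneSpectrum (𝓞 ℚ)} (hℓv : (ℓ : 𝓞 ℚ) ∉ v.asIdeal)
    (hmult : W.HasMultiplicativeReductionAt v)
    {𝔓 : Ideal (absIntegers (𝓞 ℚ) ℚ)} (h𝔓 : 𝔓 ∈ v.primesAbove)
    {τ : absoluteGaloisGroup ℚ} (hτ : τ ∈ 𝔓.inertia (absoluteGaloisGroup ℚ)) :
    r₁ τ = 1 ∧ r₂ τ = 1 := by
  sorry

/-- LOCℓ (S–M assembly: `W` semistable at the place over `ℓ`; multiplicative ⇒ CONTℓ; good ⇒ SS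
(at `ℓ^{m−1}P₁`) excludes supersingular, ORD gives the container; then DICH per `τ`
(`τ•Pᵢ − Pᵢ = ((rᵢ τ).val − 1)•Pᵢ`, `Mazur1978.eq_one_of_val_smul_eq_of_addOrderOf`) and COVER):
on the inertia group at `ℓ` ONE of the two characters is trivial — the EXACT replacement of gen-4's
`(a, b)`-sandwich.  (`ℓ = 3` allowed: SS needs `3 ≤ ℓ` only.) -/
theorem forall_eq_one_or_forall_eq_one_at_ell (W : WeierstrassCurve ℚ) [W.IsElliptic]
    [W.IsGloballyMinimal] {ℓ m : ℕ} [Fact ℓ.Prime] (hℓ2 : ℓ ≠ 2) (hm : 1 ≤ m)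
    {P₁ P₂ : geomPoints W} (hP₁ : addOrderOf P₁ = ℓ ^ m) (hP₂ : addOrderOf P₂ = ℓ ^ m)
    (hst₁ : ∀ σ : absoluteGaloisGroup ℚ, σ • P₁ ∈ AddSubgroup.zmultiples P₁)
    (hdisj : AddSubgroup.zmultiples P₁ ⊓ AddSubgroup.zmultiples P₂ = ⊥)
    {r₁ r₂ : absoluteGaloisGroup ℚ →* (ZMod (ℓ ^ m))ˣ}
    (hr₁ : ∀ σ : absoluteGaloisGroup ℚ, σ • P₁ = ((r₁ σ : (ZMod (ℓ ^ m))ˣ) : ZMod (ℓ ^ m)).val • P₁)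
    (hr₂ : ∀ σ : absoluteGaloisGroup ℚ, σ • P₂ = ((r₂ σ : (ZMod (ℓ ^ m))ˣ) : ZMod (ℓ ^ m)).val • P₂)
    {v : HeightOneSpectrum (𝓞 ℚ)} (hℓv : (ℓ : 𝓞 ℚ) ∈ v.asIdeal) (hsemi : W.IsSemistableAt v)
    {𝔓 : Ideal (absIntegers (𝓞 ℚ) ℚ)} (h𝔓 : 𝔓 ∈ v.primesAbove) :
    (∀ τ ∈ 𝔓.inertia (absoluteGaloisGroup ℚ), r₁ τ = 1) ∨
      (∀ τ ∈ 𝔓.inertia (absoluteGaloisGroup ℚ), r₂ τ = 1) := by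
  sorry

/-- TW2 (S–M assembly, the place `2` when `v₂(j) < 0`): a quadratic twist `W^{(d)}` is
multiplicative at `v` (`exists_hasMultiplicativeReductionAt_quadraticTwist_of_one_lt_valuation_j`); the
`Γ_{ℚ(√d)}`-equivariant `W^{(d)}(ℚ̄) ≃+ W(ℚ̄)` (`exists_addEquiv_geomPoints_quadraticTwist_sign`) carries the
pair to a disjoint pair on which `τ ∈ I ∩ Γ_{ℚ(√d)}` acts by `r₁ τ, r₂ τ`; MULT's argument on `W^{(d)}`
(CONT + DICH + DET) gives `rᵢ τ = 1` there, and `τ² ∈ Γ_{ℚ(√d)}` for every `τ ∈ I`.  Prime-level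
patterns: `Mazur1978.isogenyCharacter_sq_eq_one_of_one_lt_valuation_j`,
`galoisRepTorsion_pow_eq_one_of_mem_inertia_of_hasMultiplicativeReductionAt_quadraticTwist`. -/
theorem cyclicCharacter_sq_eq_one_of_one_lt_valuation_j_of_disjoint (W : WeierstrassCurve ℚ)
    [W.IsElliptic] {ℓ m : ℕ} [Fact ℓ.Prime] (hℓ2 : ℓ ≠ 2) (hm : 1 ≤ m) {P₁ P₂ : geomPoints W}
    (hP₁ : addOrderOf P₁ = ℓ ^ m) (hP₂ : addOrderOf P₂ = ℓ ^ m)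
    (hdisj : AddSubgroup.zmultiples P₁ ⊓ AddSubgroup.zmultiples P₂ = ⊥)
    {r₁ r₂ : absoluteGaloisGroup ℚ →* (ZMod (ℓ ^ m))ˣ}
    (hr₁ : ∀ σ : absoluteGaloisGroup ℚ, σ • P₁ = ((r₁ σ : (ZMod (ℓ ^ m))ˣ) : ZMod (ℓ ^ m)).val • P₁)
    (hr₂ : ∀ σ : absoluteGaloisGroup ℚ, σ • P₂ = ((r₂ σ : (ZMod (ℓ ^ m))ˣ) : ZMod (ℓ ^ m)).val • P₂)
    {v : HeightOneSpectrum (𝓞 ℚ)} (h2v : (2 : 𝓞 ℚ) ∈ v.asIdeal) (hj : 1 < v.valuation ℚ W.j)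
    {𝔓 : Ideal (absIntegers (𝓞 ℚ) ℚ)} (h𝔓 : 𝔓 ∈ v.primesAbove)
    {τ : absoluteGaloisGroup ℚ} (hτ : τ ∈ 𝔓.inertia (absoluteGaloisGroup ℚ)) :
    r₁ τ ^ 2 = 1 ∧ r₂ τ ^ 2 = 1 := by
  sorry

/-! ## §4 Global: one of `r₁¹², r₂¹²` is trivial; Frobenius; the prime case -/

/-- GLOB (M assembly, one cycle — the heart): `W` globally minimal, semistable away from `2`, `ℓ` odd,
`(P₁, P₂)` a disjoint stable pair of order `ℓᵐ`, `m ≥ 1`.  LOCℓ at ONE prime `𝔓₀ ∣ ℓ` picks `i`; for the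
other `𝔓 ∣ ℓ` conjugate (`exists_smul_eq_of_mem_primesAbove_holds`, `conj_mem_inertia_of_mem_inertia_smul`;
characters are class functions).  Then `rᵢ¹²` is trivial on EVERY inertia group: `v ∣ ℓ` (choice of `i`);
good `v ∤ ℓ` (`Mazur1978.cyclicCharacter_eq_one_of_mem_inertia`); multiplicative `v ∤ ℓ` (MULT); `v = 2`
additive: T1 (`v.valuation ℚ W.j ≤ 1`) or TW2.  Minkowski: `Mazur1978.monoidHom_eq_one_of_forall_inertia`
applied to `ψ := (powMonoidHom 12).comp rᵢ`, open kernel by OPEN + `Subgroup.isOpen_mono`. -/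
theorem pow_twelve_eq_one_or_of_disjoint (W : WeierstrassCurve ℚ) [W.IsElliptic]
    [W.IsGloballyMinimal] {ℓ m : ℕ} [Fact ℓ.Prime] (hℓ2 : ℓ ≠ 2) (hm : 1 ≤ m)
    (hss : ∀ v : HeightOneSpectrum (𝓞 ℚ), (2 : 𝓞 ℚ) ∉ v.asIdeal → W.IsSemistableAt v)
    {P₁ P₂ : geomPoints W} (hP₁ : addOrderOf P₁ = ℓ ^ m) (hP₂ : addOrderOf P₂ = ℓ ^ m)
    (hdisj : AddSubgroup.zmultiples P₁ ⊓ AddSubgroup.zmultiples P₂ = ⊥)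
    {r₁ r₂ : absoluteGaloisGroup ℚ →* (ZMod (ℓ ^ m))ˣ}
    (hr₁ : ∀ σ : absoluteGaloisGroup ℚ, σ • P₁ = ((r₁ σ : (ZMod (ℓ ^ m))ˣ) : ZMod (ℓ ^ m)).val • P₁)
    (hr₂ : ∀ σ : absoluteGaloisGroup ℚ, σ • P₂ = ((r₂ σ : (ZMod (ℓ ^ m))ˣ) : ZMod (ℓ ^ m)).val • P₂) :
    (∀ σ : absoluteGaloisGroup ℚ, r₁ σ ^ 12 = 1) ∨ (∀ σ : absoluteGaloisGroup ℚ, r₂ σ ^ 12 = 1) := by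
  sorry

/-- H5-diag (S assembly, the typed LOCAL-GLOBAL output at FULL level `m`): characters from
`exists_cyclicCharacter_of_addOrderOf`; GLOB picks `i`; at an arithmetic Frobenius `φ` over the odd good
prime `p ≠ ℓ` (`exists_isArithFrobAt_of_mem_primesAbove_holds`), `t := rᵢ φ` is a root of
`X² − a_pX + p` in `ℤ/ℓᵐ` (`Mazur1978.cyclicCharacter_sq_sub_frobeniusTrace_mul_add_eq_zero`, roles
`(p k ℓ) := (ℓ m p)`), `t¹² = 1`; A1 (branch 1, `IsUnit (p : ZMod ℓᵐ)` from `p ≠ ℓ`). -/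
theorem pow_dvd_frobNorm_of_disjoint (W : WeierstrassCurve ℚ) [W.IsElliptic] [W.IsGloballyMinimal]
    (ℓ m : ℕ) [Fact ℓ.Prime] (hℓ2 : ℓ ≠ 2) (hm : 1 ≤ m)
    (hss : ∀ v : HeightOneSpectrum (𝓞 ℚ), (2 : 𝓞 ℚ) ∉ v.asIdeal → W.IsSemistableAt v)
    {P₁ P₂ : geomPoints W} (hP₁ : addOrderOf P₁ = ℓ ^ m) (hP₂ : addOrderOf P₂ = ℓ ^ m)
    (hst₁ : ∀ σ : absoluteGaloisGroup ℚ, σ • P₁ ∈ AddSubgroup.zmultiples P₁)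
    (hst₂ : ∀ σ : absoluteGaloisGroup ℚ, σ • P₂ ∈ AddSubgroup.zmultiples P₂)
    (hdisj : AddSubgroup.zmultiples P₁ ⊓ AddSubgroup.zmultiples P₂ = ⊥)
    (p : ℕ) [Fact p.Prime] (hp2 : p ≠ 2) (hpℓ : p ≠ ℓ) (hgood : W.HasGoodReductionAtPrime p) :
    (ℓ : ℤ) ^ m ∣ frobNorm W p := by
  sorry

/-- PRIME (S assembly, `k = 1`, everything landed + A1): a stable line of prime order `ℓ ≥ 3` on `W`
globally minimal and semistable away from `2`: `r = b·χ̄ᵏ`, `b¹² = 1`, `r = χ̄ᵏ` on `I_ℓ`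
(`Mazur1978.exists_forall_isogenyCharacter_eq_mul_pow`); `k ≡ 0, 1 (mod ℓ−1)` by
`Mazur1978.modEq_zero_or_one_of_hasGoodReductionAtPrime` (good at `ℓ`) /
`modEq_zero_or_one_of_hasMultiplicativeReductionAt` (multiplicative at `ℓ`); so `r¹² = 1` or
`r¹² = χ̄¹²`; at Frobenius over `p`: `t¹² = 1` or `t¹² = p¹²`
(`modNCyclotomicCharacter_eq_residueCard_of_isArithFrobAt`); A1 (both branches).  `geomPoints`/`geomTorsion`
bridge as in `Mazur1978.cyclicCharacter_sq_sub_frobeniusTrace_mul_add_eq_zero` (`k = 1`). -/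
theorem dvd_frobNorm_of_stableLine_prime (W : WeierstrassCurve ℚ) [W.IsElliptic] [W.IsGloballyMinimal]
    (ℓ : ℕ) [Fact ℓ.Prime] (hℓ2 : ℓ ≠ 2)
    (hss : ∀ v : HeightOneSpectrum (𝓞 ℚ), (2 : 𝓞 ℚ) ∉ v.asIdeal → W.IsSemistableAt v)
    {P : geomPoints W} (hP : addOrderOf P = ℓ)
    (hst : ∀ σ : absoluteGaloisGroup ℚ, σ • P ∈ AddSubgroup.zmultiples P)
    (p : ℕ) [Fact p.Prime] (hp2 : p ≠ 2) (hpℓ : p ≠ ℓ) (hgood : W.HasGoodReductionAtPrime p) :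
    (ℓ : ℤ) ∣ frobNorm W p := by
  sorry

/-! ## §5 Counting end (CUBE) and the diameter -/

/-- C1³ (PROVED): exponents `max 1 ⌊k/2⌋` at every prime give `d ∣ n³` (`k ≤ 3·max 1 ⌊k/2⌋`). -/
theorem dvd_pow_three_of_forall_pow_dvd {d n : ℕ} (hd : 0 < d) (hn : 0 < n)
    (h : ∀ ℓ : ℕ, ℓ.Prime → ℓ ∣ d → ℓ ^ max 1 (d.factorization ℓ / 2) ∣ n) : d ∣ n ^ 3 := by
  rw [← Nat.factorization_le_iff_dvd hd.ne' (pow_pos hn 3).ne', Nat.factorization_pow]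
  refine Finsupp.le_def.mpr fun ℓ => ?_
  rw [Finsupp.smul_apply, smul_eq_mul]
  by_cases hℓ : ℓ.Prime
  · by_cases hℓd : ℓ ∣ d
    · have h2 : max 1 (d.factorization ℓ / 2) ≤ n.factorization ℓ :=
        (hℓ.pow_dvd_iff_le_factorization hn.ne').mp (h ℓ hℓ hℓd)
      omega
    · rw [Nat.factorization_eq_zero_of_not_dvd hℓd]; exact Nat.zero_le _
  · rw [Nat.factorization_eq_zero_of_not_prime d hℓ]; exact Nat.zero_le _

/-- ISO (S): semistability at a place of `𝓞 ℚ` is an isogeny invariant (good: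
`IsIsogenous.hasGoodReductionAt_iff_of_isIsogenous`; multiplicative: the `𝓞 ℚ`-place step inside the
landed `hasMultiplicativeReductionAt_of_isIsogenous`, `conductorExponent_eq_one_iff_holds`).  Needed to
move `hss` (and `HasGoodReductionAtPrime p`, `hasGoodReductionAtPrime_iff_hasGoodReductionAt_ringOfIntegers`)
from `W₁` to the middle curve. -/
theorem isSemistableAt_of_isIsogenous {W W' : WeierstrassCurve ℚ} [W.IsElliptic] [W'.IsElliptic]
    (h : W.IsIsogenous W') (v : HeightOneSpectrum (𝓞 ℚ)) (hv : W.IsSemistableAt v) :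
    W'.IsSemistableAt v := by
  sorry

/-- C0³ (the typed output of the line, Mazur–Kenku-free): for `W₁` globally minimal and semistable away
from `2`, a cyclic isogeny out of `W₁` has degree dividing `16·(n₁₂(p₀)·n₁₂(p₁))³` for any two distinct
odd good primes.  Per odd `ℓᵏ ∥ deg`: cyclic `ψ : W₁ → W''` of degree `ℓᵏ`
(`Isogeny.exists_isCyclic_degree_eq_of_dvd`); `k = 1`: G0 + PRIME; `k ≥ 2`: M1 + H5-diag on the middle
curve `V₁` (ISO for `hss`/good reduction, `frobeniusTrace_eq_of_isIsogenous` for `n₁₂`) at the `pᵢ ≠ ℓ`;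
C1³; the `2`-part `∣ 16` by the landed `Summit.ABC.ABC.Theorems.isogeny_isCyclic_degree_ne_thirtyTwo`. -/
def CyclicDegreeDvdFrobNormCube : Prop :=
  ∀ (W₁ W₂ : WeierstrassCurve ℚ) [W₁.IsElliptic] [W₂.IsElliptic] [W₁.IsGloballyMinimal],
    (∀ v : HeightOneSpectrum (𝓞 ℚ), (2 : 𝓞 ℚ) ∉ v.asIdeal → W₁.IsSemistableAt v) →
    ∀ (φ : Isogeny W₁ W₂), φ.IsCyclic →
    ∀ (p₀ p₁ : ℕ) [Fact p₀.Prime] [Fact p₁.Prime], p₀ ≠ 2 → p₁ ≠ 2 → p₀ ≠ p₁ →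
      W₁.HasGoodReductionAtPrime p₀ → W₁.HasGoodReductionAtPrime p₁ →
      φ.degree ∣ 16 * ((frobNorm W₁ p₀ * frobNorm W₁ p₁).natAbs) ^ 3

theorem cyclicDegreeDvdFrobNormCube : CyclicDegreeDvdFrobNormCube := by
  sorry

/-- k1's replacement input, verbatim (`…Sketch.Ideas1.FreyIsogenyDiameter`). -/
def FreyIsogenyDiameter : Prop :=
  ∀ ε : ℝ, 0 < ε → ∃ C : ℝ, ∀ a b : ℤ, IsCoprime a b → a * b * (a + b) ≠ 0 →
    ∀ (W₁ W₂ : WeierstrassCurve ℚ) [W₁.IsElliptic] [W₂.IsElliptic],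
      (freyCurve a b).IsIsogenous W₁ → (freyCurve a b).IsIsogenous W₂ →
      ∀ φ : Isogeny W₁ W₂, φ.IsCyclic →
        (φ.degree : ℝ) ≤ C * (((freyCurve a b).conductorNorm ℤ : ℕ) : ℝ) ^ ε

/-- ASSEMBLY (S, as gen 3/4 with `δ = ε/72`): C0³ at a globally minimal model of `W₁` (degree is model
independent, `VariableChange.toIsogeny`), semistable away from `2` (the Frey curve is:
`hasMultiplicativeReductionAt_freyCurve_of_ne_two`; ISO), k1 H7 (`0 < n₁₂(p) ≤ (p⁶+1)²`, Hasse) and k1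
H8 (two odd good primes `≪_δ N^δ`); then k1's `definiteRTControlPrime_of_diameter stub_takahashi hDiam`
closes the crux with `C(ε) = 4·C_diam(ε/2)²` in place of `4·163²`. -/
theorem freyIsogenyDiameter_of_cube (h0 : CyclicDegreeDvdFrobNormCube) : FreyIsogenyDiameter := by
  sorry

/-! ## Sanity.  (1) `11a3 →⁵ 11a1 →⁵ 11a2` (cyclic `25`, `k = 2`, `m = 1`): middle curve `11a1` has a
RATIONAL `5`-torsion point (`r₂ = 1` exactly), `a₃ = −1`, `s₁₂(−1,3) = −1358`, and `5 ∣ n₁₂(3) = 532800`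
(even `25 ∣`).  (2) k3's `(ℤ/9)²` unipotent witness `diag(4,7)` is KILLED by the container hypothesis:
`(τ−1) = diag(3,6)` has `9 > 3` image points, all `3`-torsion — it cannot be an inertia element at a
multiplicative or ordinary place; DICH is exactly what the single-line gen-4 cut lacked. -/
example : (5 : ℤ) ∣ 3 ^ 12 + 1 - (-1358) ∧ (3 : ℤ) ^ 12 + 1 - (-1358) = 532800 := by decide
example : ¬ (9 : ℕ) ≤ 3 ∧ (3 * 4) % 9 = 3 ∧ (6 * 7) % 9 = 6 := by decide
/-- `k ≤ 3 · max 1 ⌊k/2⌋` for the exponents that occur. -/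
example : ∀ k ∈ Finset.range 40, k ≤ 3 * max 1 (k / 2) := by decide

end Summit.ABC.ABC.Cruxes.DefiniteRTControlPrime.Sketch.Ideas2g5
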